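import Summits.BirchSwinnertonDyer.BirchSwinnertonDyer.Theorems.AlignedTransportAtTwoMainConjectureOfRankZeroBSDAtTwoFineRoadInfResSurj
import Literature.NumberTheory.EllipticCurves.SelmerPInftyRelModelAction
import Literature.NumberTheory.EllipticCurves.SelmerCorankAssembly
import Literature.NumberTheory.EllipticCurves.IwasawaTowerTorsionProofs
import HarnessLib

/-!
# Route `GenusKolyvaginAtTwo`, LINE 6, KEY crux Q3 `EquivariantKolyvaginExactAtTwo`
# (stmt-BirchSwinnertonDyer-24882): INFLATION–RESTRICTION FOR A FINITE GALOIS EXTENSION —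
# `H¹(K, E[p^∞]) ≅ H¹(L, E[p^∞])^{Gal(L/K)}` when `E(L)[p] = 0`
# (helper, PROVED; seat `bsd-line-gk2-p3` g9, cell `bsd-f1-sign2`; stub S1 of the eigen/ℚ_ℓ
# architecture of memo Q3-ARCH v2, evidence #6 on the item)

The architecture memo for Q3 (McCallum §5 at `p = 2` on `Δ(E) < 0`) recommends running
Kolyvagin's argument on the EIGEN SUBGROUPS `H¹(K, E[2^∞])^{τ = ±1}` with `ℚ_ℓ`-local dualities,
because Kolyvagin's classes are eigen and, on the habitat, EIGEN CLASSES OVER `K` ARE CLASSES OVER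
`ℚ` (resp. over `ℚ` for the twist): the inflation–restriction isomorphism
`res : H¹(ℚ, E[2^∞]) ≅ H¹(K, E[2^∞])^{Gal(K/ℚ)}`, valid because `E(K)[2] = 0` (full `2`-adic image
and `K ≠ ℚ(√Δ_E)`). This file proves that isomorphism, in the tree's subgroup model of Galois
cohomology (`Literature.NumberTheory.EllipticCurves.subgroupH1`, `resOfLe`, `conjH1`;
`galRange L ≤ Γ_K` = the absolute Galois group of the chosen copy of `L` in `K̄`, open and normal
of index `[L : K]` for `L/K` Galois, `RelModel.normal_galRange`; `liftToAbsGal L σ` = transported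
lifts of the `σ ∈ Gal(L/K)`, a full set of coset representatives,
`RelModel.exists_liftToAbsGal_inv_mul_mem_galRange`), for EVERY finite Galois extension `L/K` of
number fields, every Weierstrass curve `W/K` and every prime `p`, under the single hypothesis
`E[p^∞]^{Γ_L} = 0` (no `L`-rational `p`-torsion):

* §1 `resOfLe_galRange_injective` — `res : H¹(Γ_K, E[p^∞]) → H¹(Γ_L, E[p^∞])` is INJECTIVE
  (att-p4 g3's generic `InfResSharp.resOfLe_injective_of_fixedPoints_eq_bot`);
* §2 `forall_conjH1_eq_of_forall_liftToAbsGal` — a class over `L` is `Γ_K`-invariant iff it is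
  fixed by the conjugations `conj_{σ̃}`, `σ ∈ Gal(L/K)` (inner automorphisms act trivially,
  `conjH1_of_mem_holds`);
* §3 `mem_range_resOfLe_galRange_iff` — the IMAGE of restriction is exactly the
  `Gal(L/K)`-invariant classes (att-p4 g3's generic `InfResSurj.exists_resOfLe_eq_of_forall_conjH1_eq`);
  with §1: **`H¹(K, E[p^∞]) ≅ H¹(L, E[p^∞])^{Gal(L/K)}`** (`existsUnique_resOfLe_eq_of_forall_conjH1_eq`).
  (`H¹(Γ_K, ·)` is taken in the model `subgroupH1 ⊤`; the passage to the absolute-Galois-group model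
  of `L` and to the intrinsic action of `Gal(L/K)` is the tree's `SelmerPInftyRestriction.modelIso`
  / `RelModel.modelIso_relConjH1Primary`.)

Reading for Q3 (`K ↦ ℚ`, `L ↦ K` imaginary quadratic, `p = 2`, `Gal = {1, τ}`): with `E(K)[2] = 0`,
`H¹(ℚ, E[2^∞]) = H¹(K, E[2^∞])^{τ = 1}` and (applied to the twist `E^K`, same group `E[2^∞]` with
`τ ↦ −τ`) `H¹(ℚ, E^K[2^∞]) = H¹(K, E[2^∞])^{τ = −1}`: the two eigen subgroups ARE the `ℚ`-level
cohomology groups of `E` and `E^K`, so Kolyvagin's eigen classes and the eigen parts of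
`Sel_{2^∞}(E/K)` live over `ℚ`. Everything here is PROVED from tree theorems; no named fact, no
definition, no `sorry`. Helper for 24882 (`--supports … --as helper`); BSD is not proved by this.

References: [SerreGaloisCohomology1997] I §2.6 (b) (inflation–restriction with `H²`), II §1.1;
[GrossLMS1991] §5 (5.1) (the `Gal(K/ℚ)`-action); [McCallumLMS1991] §3 (restriction is an injection
of `Gal(L/ℚ)`-modules); T. and V. Dokchitser, Ann. of Math. 172 (2010), proof of Lemma 4.14
(`Sel(E/K) → Sel(E/F)^G`).
-/

set_option autoImplicit false
set_option linter.dupNamespace false -- tree convention: `Summit.BirchSwinnertonDyer.BirchSwinnertonDyer.Theorems` (summit = sub-problem)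

noncomputable section

open scoped Classical

namespace Summit.BirchSwinnertonDyer.BirchSwinnertonDyer.Theorems.GenusExact.QuadInfRes

open WeierstrassCurve Literature.NumberTheory.EllipticCurves
open Summit.BirchSwinnertonDyer.BirchSwinnertonDyer.Theorems.AlignedTransportAtTwoFineRoad

universe u

variable {K : Type u} [Field K] [NumberField K] (L : Type u) [Field L] [NumberField L]
  [Algebra K L] [IsGalois K L] (W : WeierstrassCurve K) (p : ℕ)

/-! ## §1 Injectivity of restriction to `Γ_L` when `E(L)[p] = 0` -/

/-- **`res : H¹(K, E[p^∞]) → H¹(L, E[p^∞])` is injective when `E[p^∞]^{Γ_L} = 0`** (`L/K` finite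
Galois; in the subgroup model: restriction from `⊤ = Γ_K` to the open normal subgroup `galRange L`).
The kernel of restriction is inflated from `Gal(L/K)`-cohomology with coefficients in
`E[p^∞]^{Γ_L} = 0`. [cite: SerreGaloisCohomology1997, I §2.6 (inflation–restriction)] -/
theorem resOfLe_galRange_injective
    (hfix : FixedPoints.addSubgroup (galRange (K := K) L) (geomPrimaryTorsion W p) = ⊥) :
    Function.Injective (W.resOfLe p (le_top : galRange (K := K) L ≤ ⊤)) :=
  haveI : (galRange (K := K) L).Normal := RelModel.normal_galRange (K := K) L
  InfResSharp.resOfLe_injective_of_fixedPoints_eq_bot (M := W.geomPrimaryTorsion p)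
    (le_top : galRange (K := K) L ≤ ⊤)
    (fun g _ h hh ↦ (inferInstance : (galRange (K := K) L).Normal).conj_mem' h hh g)
    (fun m ↦ W.continuous_smul_geomPrimaryTorsion p m) hfix

/-! ## §2 Invariance under `Γ_K` = invariance under the lifts of `Gal(L/K)` -/

/-- **A class of `H¹(Γ_L, E[p^∞])` is fixed by every `conj_g`, `g ∈ Γ_K`, as soon as it is fixed by
the conjugations `conj_{σ̃}`** by the transported lifts `σ̃ = liftToAbsGal L σ`, `σ ∈ Gal(L/K)`:
every `g` is `σ̃ n` with `n ∈ Γ_L` (`RelModel.exists_liftToAbsGal_inv_mul_mem_galRange`) and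
`conj_n = id` on `H¹(Γ_L, ·)` for `n ∈ Γ_L` (inner automorphisms, `conjH1_of_mem_holds`). (The
normality instance is an argument; it holds by `RelModel.normal_galRange`.)
[cite: GrossLMS1991, §5 (5.1)] [cite: SerreGaloisCohomology1997, II §1.1] -/
theorem forall_conjH1_eq_of_forall_liftToAbsGal [hN : (galRange (K := K) L).Normal]
    (c : W.subgroupH1 p (galRange (K := K) L))
    (hc : ∀ σ : L ≃ₐ[K] L, W.conjH1 p (galRange (K := K) L) (liftToAbsGal (K := K) L σ) c = c)
    (g : Field.absoluteGaloisGroup K) : W.conjH1 p (galRange (K := K) L) g c = c := by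
  obtain ⟨σ, hσ⟩ := RelModel.exists_liftToAbsGal_inv_mul_mem_galRange (K := K) L g
  have hmul : g = liftToAbsGal (K := K) L σ * ((liftToAbsGal (K := K) L σ)⁻¹ * g) := by group
  rw [hmul, W.conjH1_mul_holds p (galRange (K := K) L), AddMonoidHom.comp_apply,
    W.conjH1_of_mem_holds p (galRange (K := K) L) hσ, AddMonoidHom.id_apply, hc]

/-! ## §3 The image of restriction: exactly the `Gal(L/K)`-invariant classes -/

omit [NumberField K] [NumberField L] [IsGalois K L] in
/-- A restricted class is invariant under every conjugation (no hypothesis on fixed points).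
[cite: SerreGaloisCohomology1997, I §2.6] -/
theorem conjH1_resOfLe_galRange [hN : (galRange (K := K) L).Normal]
    (c' : W.subgroupH1 p (⊤ : Subgroup (Field.absoluteGaloisGroup K)))
    (g : Field.absoluteGaloisGroup K) :
    W.conjH1 p (galRange (K := K) L) g (W.resOfLe p (le_top : galRange (K := K) L ≤ ⊤) c') =
      W.resOfLe p (le_top : galRange (K := K) L ≤ ⊤) c' :=
  conjH1_resOfLe_of_mem (M := W.geomPrimaryTorsion p) (le_top : galRange (K := K) L ≤ ⊤)
    (Subgroup.mem_top _) c'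

/-- **`res(H¹(K, E[p^∞])) = H¹(L, E[p^∞])^{Gal(L/K)}` when `E[p^∞]^{Γ_L} = 0`** (`L/K` finite
Galois): a class over `L` is a restriction from `K` iff it is fixed by the conjugations by the
lifts of `Gal(L/K)`. With §1, restriction is an ISOMORPHISM `H¹(K, E[p^∞]) ≅ H¹(L, E[p^∞])^{Gal(L/K)}`
— both outer terms `H¹(Gal(L/K), E[p^∞]^{Γ_L})`, `H²(Gal(L/K), E[p^∞]^{Γ_L})` of the
inflation–restriction sequence vanish with their coefficients. For `K = ℚ`, `L` imaginary
quadratic with `E(L)[2] = 0`, `p = 2`: the `τ`-INVARIANT subgroup of `H¹(L, E[2^∞])` IS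
`H¹(ℚ, E[2^∞])` — stub S1 of the eigen architecture for Q3.
[cite: SerreGaloisCohomology1997, I §2.6 (b)] [cite: McCallumLMS1991, §3] -/
theorem mem_range_resOfLe_galRange_iff [hN : (galRange (K := K) L).Normal]
    (hfix : FixedPoints.addSubgroup (galRange (K := K) L) (geomPrimaryTorsion W p) = ⊥)
    (c : W.subgroupH1 p (galRange (K := K) L)) :
    c ∈ (W.resOfLe p (le_top : galRange (K := K) L ≤ ⊤)).range ↔
      ∀ σ : L ≃ₐ[K] L, W.conjH1 p (galRange (K := K) L) (liftToAbsGal (K := K) L σ) c = c := by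
  constructor
  · rintro ⟨c', rfl⟩ σ
    exact conjH1_resOfLe_galRange L W p c' _
  · intro hc
    have hopen : IsOpen (((galRange (K := K) L).subgroupOf ⊤ :
        Subgroup (⊤ : Subgroup (Field.absoluteGaloisGroup K))) :
        Set (⊤ : Subgroup (Field.absoluteGaloisGroup K))) := by
      rw [Subgroup.coe_subgroupOf]
      exact (isOpen_galRange (K := K) L).preimage continuous_subtype_val
    obtain ⟨c', hc'⟩ := InfResSurj.exists_resOfLe_eq_of_forall_conjH1_eq
      (M := W.geomPrimaryTorsion p) (le_top : galRange (K := K) L ≤ ⊤) hfix hopen c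
      (fun g _ ↦ forall_conjH1_eq_of_forall_liftToAbsGal L W p c hc g)
    exact ⟨c', hc'⟩

/-- **The inflation–restriction isomorphism for `L/K` finite Galois, packaged**: under
`E[p^∞]^{Γ_L} = 0`, for every `Gal(L/K)`-fixed class `c` over `L` there is a UNIQUE class over `K`
restricting to it. [cite: SerreGaloisCohomology1997, I §2.6 (b)] -/
theorem existsUnique_resOfLe_eq_of_forall_conjH1_eq [hN : (galRange (K := K) L).Normal]
    (hfix : FixedPoints.addSubgroup (galRange (K := K) L) (geomPrimaryTorsion W p) = ⊥)
    (c : W.subgroupH1 p (galRange (K := K) L))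
    (hc : ∀ σ : L ≃ₐ[K] L, W.conjH1 p (galRange (K := K) L) (liftToAbsGal (K := K) L σ) c = c) :
    ∃! c' : W.subgroupH1 p (⊤ : Subgroup (Field.absoluteGaloisGroup K)),
      W.resOfLe p (le_top : galRange (K := K) L ≤ ⊤) c' = c := by
  obtain ⟨c', hc'⟩ := (mem_range_resOfLe_galRange_iff L W p hfix c).mpr hc
  exact ⟨c', hc', fun c'' hc'' ↦ resOfLe_galRange_injective L W p hfix (hc''.trans hc'.symm)⟩

/-! ## §4 The quadratic case: one conjugation suffices (`Gal(K/ℚ) = {1, τ}` for Q3) -/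

/-- **Quadratic `L/K`: the image of restriction is the set of classes fixed by `conj_{τ̃}` for ONE
lift `τ̃` of the non-trivial automorphism**, given `E[p^∞]^{Γ_L} = 0`. For Q3: `K ↦ ℚ`, `L ↦ K`
imaginary quadratic, `τ` = complex conjugation, `p = 2` — `H¹(ℚ, E[2^∞]) = H¹(K, E[2^∞])^{τ}`.
[cite: GrossLMS1991, §5 (5.1)] [cite: SerreGaloisCohomology1997, I §2.6 (b)] -/
theorem mem_range_resOfLe_galRange_iff_of_finrank_eq_two [hN : (galRange (K := K) L).Normal]
    (h2 : Module.finrank K L = 2) {τ : L ≃ₐ[K] L} (hτ : τ ≠ 1)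
    (hfix : FixedPoints.addSubgroup (galRange (K := K) L) (geomPrimaryTorsion W p) = ⊥)
    (c : W.subgroupH1 p (galRange (K := K) L)) :
    c ∈ (W.resOfLe p (le_top : galRange (K := K) L ≤ ⊤)).range ↔
      W.conjH1 p (galRange (K := K) L) (liftToAbsGal (K := K) L τ) c = c := by
  rw [mem_range_resOfLe_galRange_iff L W p hfix c]
  constructor
  · exact fun h ↦ h τ
  · intro hc σ
    -- fixed by `conj_{τ̃}` ⟹ fixed by every `conj_g`: `Γ_K = galRange L ⊔ galRange L · τ̃`
    have hall : ∀ g : Field.absoluteGaloisGroup K, W.conjH1 p (galRange (K := K) L) g c = c := by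
      intro g
      rcases (xor_galRange L h2 hτ g).or with hg | hg
      · have hmul : g = (g * (liftToAbsGal (K := K) L τ)⁻¹) * liftToAbsGal (K := K) L τ := by group
        rw [hmul, W.conjH1_mul_holds p (galRange (K := K) L), AddMonoidHom.comp_apply, hc,
          W.conjH1_of_mem_holds p (galRange (K := K) L) hg, AddMonoidHom.id_apply]
      · rw [W.conjH1_of_mem_holds p (galRange (K := K) L) hg, AddMonoidHom.id_apply]
    exact hall _

/-! ## §5 Discharging the fixed-point hypothesis from «no `L`-rational `p`-torsion» -/

omit [IsGalois K L] in
/-- **`E(L)[p] = 0 ⟹ E[p^∞]^{Γ_L} = 0` in the subgroup model**: if the base change `W⁄L` has no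
`L`-rational point of order `p`, then no non-zero point of `E[p^∞] ⊆ E(K̄)` is fixed by
`galRange L` (transport along the equivariant identification
`primaryBaseChangeEquiv : E[p^∞](K̄) ≃ E_L[p^∞](L̄)` and the tree's `eq_zero_of_forall_smul_eq`
for `W⁄L`). This is the hypothesis `hfix` of §1–§4; for Q3 (`K ↦ ℚ`, `L ↦ K`, `p = 2`) it is
«`E(K)[2] = 0`», true on the habitat (`ρ̄_{E,2}` onto, `K ≠ ℚ(√Δ_E)`). [folklore] -/
theorem fixedPoints_galRange_eq_bot_of_noTorsion
    (hL : ∀ P : (W.baseChange L).toAffine.Point, p • P = 0 → P = 0) :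
    FixedPoints.addSubgroup (galRange (K := K) L) (geomPrimaryTorsion W p) = ⊥ := by
  rw [eq_bot_iff]
  intro m hm
  rw [AddSubgroup.mem_bot]
  have hm' : ∀ n : galRange (K := K) L, n • m = m := fun n ↦ (FixedPoints.mem_addSubgroup _ _ _).1 hm n
  have he : primaryBaseChangeEquiv L W p m = 0 :=
    (W.baseChange L).eq_zero_of_forall_smul_eq hL fun σ ↦ by
      rw [← primaryBaseChangeEquiv_smul, hm' (resGalToRange (K := K) L σ)]
  exact (map_eq_zero_iff _ (primaryBaseChangeEquiv L W p).injective).1 he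

/-- **The quadratic inflation–restriction isomorphism with the arithmetic hypothesis**: for `L/K` a
quadratic Galois extension of number fields, `τ ∈ Gal(L/K)` non-trivial, and `W⁄L` without
`L`-rational `p`-torsion, restriction `H¹(Γ_K, E[p^∞]) → H¹(Γ_L, E[p^∞])` is INJECTIVE and its image is
EXACTLY the set of classes fixed by `conj_{τ̃}`. Q3 reading (`K ↦ ℚ`, `L ↦ K` imaginary quadratic,
`p = 2`, `E(K)[2] = 0`): `H¹(ℚ, E[2^∞]) = H¹(K, E[2^∞])^{τ}`.
[cite: SerreGaloisCohomology1997, I §2.6 (b)] [cite: GrossLMS1991, §5 (5.1)] -/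
theorem infRes_quadratic_of_noTorsion [hN : (galRange (K := K) L).Normal]
    (h2 : Module.finrank K L = 2) {τ : L ≃ₐ[K] L} (hτ : τ ≠ 1)
    (hL : ∀ P : (W.baseChange L).toAffine.Point, p • P = 0 → P = 0) :
    Function.Injective (W.resOfLe p (le_top : galRange (K := K) L ≤ ⊤)) ∧
      ∀ c : W.subgroupH1 p (galRange (K := K) L),
        c ∈ (W.resOfLe p (le_top : galRange (K := K) L ≤ ⊤)).range ↔
          W.conjH1 p (galRange (K := K) L) (liftToAbsGal (K := K) L τ) c = c :=
  ⟨resOfLe_galRange_injective L W p (fixedPoints_galRange_eq_bot_of_noTorsion L W p hL),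
    fun c ↦ mem_range_resOfLe_galRange_iff_of_finrank_eq_two L W p h2 hτ
      (fixedPoints_galRange_eq_bot_of_noTorsion L W p hL) c⟩

end Summit.BirchSwinnertonDyer.BirchSwinnertonDyer.Theorems.GenusExact.QuadInfRes

end
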